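import Summits.QuantumFields.YangMills.Theorems.BalabanUVNodesN11TStepOldBranchInnerChartFluctuationSlicesOfProvisos
import Summits.QuantumFields.YangMills.Theorems.BalabanUVNodesN11StepWeightSupportOfRecord

/-!
# DAG node N11 — THE (O3′) DISJUNCTION AND `PresentChildObligations` FROM THE CORE PROVISOS AT A FLUCTUATION-PRODUCT SOCKET, SUPPORT CLAUSE CUT IN TWO: def-T's half
# (`support_of_wOfRecord_ne_zero`: the (3.2)∕(3.3) events at the cubes of `Ω_{k+1}(s′)` wherever the step weight is non-zero) DISCHARGED; displayed is only the BRIDGE from those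
# events to the chart's charted set `S`

HEADER — WORK-UNIT METADATA.  Cell `pub-ymgap`, YM-PLAN Track A (HUMAN RULING D-0062), WIDTH SEAT `pub-ymgap-dag-n11-w6` (g3; R399 (3a) re-mint) on NODE n11 [B14],
route `BalabanUVNodes` rev 29, jail key K1⁷ `StabilityBAtRecordR13SepCoPH` = stmt-QuantumFields-20542 (helper lane, `--kind proof --supports stmt-QuantumFields-20542 --as helper`,
count-neutral; K1⁹ = stmt-QuantumFields-27364 of record — dag-lead KEY MAP v2, MIS-KEY rule R463 (4)(a)).  [I] = [Balaban1987RG1], [III] = [Balaban1988Convergent].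
The fluctuation-socket twin of dag-n11-w2 g4's `…TStepOldBranchPrivateInnerChartOfSupport` (CLAIM-11; GO to this seat I.≈39200): ONE composition BY NAME of this seat's
`…FluctuationSlicesOfProvisos` (p638582: §1 the (O3′) disjunction from `θ.Provisos₁₃CoPH` + Theorem 1's level-`k` form + rows + socket + `hwS` + (hIslice) + (hslice); §2 the
J-twin) with dag-n11-w2 g4's `…N11StepWeightSupportOfRecord.support_of_wOfRecord_ne_zero` (p638096).

WHY THIS FILE.  E's support clause `hwS : q ∉ S → w(s′)(e_β q, Ū(e_β q)) = 0` («the step weight's graph section lives in the charted set») mixes two owners: def-T's step weight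
(whose non-vanishing FORCES the (3.2) plaquette-smallness events `PlaqSmallOn … (ε_{k+1}η²_{k+1}) (UkLoc c Ū)` and the (3.3) small-approximate-fluctuation events `SmallApproxFluct …
(2δ_k) U Ū c` at every `χ`-cube `c` of `Ω_{k+1}(s′)`, under `0 < sideD` — dag-n11-w2 g4's theorem) and the chart seat (whose charted set `S` must CONTAIN the configurations where
those events hold).  THIS FILE displays only the second half, `hbridge : ∀ q, (events at q) → q ∈ S`, and derives `hwS` by contraposition.  NET at a fluctuation-product socket, by
name: the (O3′) disjunction of `PresentChildObligations` — and `PresentChildObligations` itself given (O1′)+(O2) — from «`Provisos₁₃CoPH` + `HasSect2FormAtZS` at level `k` + residual ∕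
operand measurability rows + the socket + `0 < sideD` + the BRIDGE (events ⇒ charted set) + (hIslice) + THE PER-SLICE (3.23) IDENTITY».

WHAT THIS FILE PROVES (0 `def`, 0 `sorry`, standard axioms).  §1 ★★★★★★★ `slotsTOfRecord₁₃H_succ_O3_of_hasSect2FormAtZS_of_fluctuationSlices_of_support` ·
§2 ★★★★★★★ `presentChildObligations_of_bounds_of_hasSect2FormAtZS_of_fluctuationSlices_of_support`.

HONEST FRAMING.  Helper lane, count-neutral; compositions BY NAME; the bridge, the socket data, the rows, (hIslice), the per-slice identity and (O1′)∕(O2) are HYPOTHESES; the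
bridge's content (the chart covers the (3.2)∕(3.3) region — for the Lie–Haar road: background regularity in plaquette currency) is LOCATED, not derived; NO chart of Bałaban's
((47), [III] (3.10)–(3.25)) asserted; NO Jacobian evaluated; NO Gaussian integration performed; nothing of [I] §2 ∕ [III] §3 ∕ Thm 2 asserted; (B4) ∕ (S-α) ∕ (O3′) NOT closed;
N11 NOT discharged; K1⁷ ∕ K1⁹ NOT closed, no registered stub touched; counts unmoved (typed 28∕28 · discharged 5∕27 · A 5∕28).  One finite `𝕋⁴_{L^K}` programme at fixed
`ε = L^{−K}`; R4 closes only the conditional finite-𝕋⁴ rung `BalabanLadder.UV` — NOT ℝ⁴, NOT OS, NOT a mass gap, NOT Clay.  No `sorry`, `axiom`, `def`, `instance`, `notation`.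
Sources (SHAPE ∕ bookkeeping only): [I] (0.4) p.253, §2 p.267; [III] Thm 1 p.262, Thm 2 p.263, (2.18) p.257, (2.20)–(2.21) p.258, (3.1) p.264, (3.2)–(3.5) p.265, (3.23)–(3.25) p.270, §3 p.279.
-/

noncomputable section

open MeasureTheory ProbabilityTheory
open scoped ENNReal NNReal BigOperators Matrix.Norms.L2Operator

namespace Summit.QuantumFields.YangMills.Theorems.BalabanUVNodesN11TStepOldBranchInnerChartFluctuationSlicesOfSupport

open Literature.MathematicalPhysics.QuantumFieldTheory.Balaban1983to89
open Literature.MathematicalPhysics.QuantumFieldTheory.Balaban1983to89.T4AveragingDisintegration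
open BalabanUVNodesN11StepWeightSupportOfRecord (support_of_wOfRecord_ne_zero)
open BalabanUVNodesN11Sect3SupplyChainDefs (PresentChildObligations)
open BalabanUVNodesN11Sect3SupplySpliceOwnBoundary (graftAboveB)
open Node00 hiding SU
open Node00.Tk T4Continuum B14.Eq218Concrete B14.Sect3Decomp
open B10Eq42TorusConstraint (bondsIn)
open T4AdjointCovariance (insA)

variable {F : T4Family} {N : ℕ} [NeZero N]

/-- ★★★★★★★ **THE (O3′) DISJUNCTION FROM THE CORE PROVISOS AT A FLUCTUATION-PRODUCT SOCKET, def-T's HALF OF THE SUPPORT CLAUSE DISCHARGED** (`hwS` ⟸ `0 < sideD` + `hbridge` by `support_of_wOfRecord_ne_zero` and contraposition; then this seat's `…_of_fluctuationSlices_of_provisos`).  Original reading:  dag-n11-w2 g4's ★★★★★★★ `…_of_innerChart_of_provisos` at `X := (↥sA → FluctV N) × X₂`,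
`κ := Kernel.const _ (Measure.pi fun _ => volume) ⊗ₖ κ₂`, with its `hinner₀` PRODUCED from (hIslice) + (hslice) by this seat's nonnegative-slices Fubini face (`…OfWeightLaws` §1): laws by
`WtOfRecord₁₃H_laws h.zhLaws`, positivity by `sect2Operand_pos`, the new weights' measurability by `measurable_tkWeightsOfRecordP_ζ∕_w` from the displayed `hζm`∕`hqm'`, the new
operand's at a topped old branch by `hΦm` + C1's `update_succ_mem_admSSeq_succ`, the slice map's by `measurable_update` ∘ `measurable_updateFinset`.
[cite: Balaban1988Convergent, Thm 1 p.262, Thm 2 p.263, §3 p.279, (3.23)–(3.25) p.270, (2.18) p.257, (2.20)–(2.21) p.258, (3.1) p.264, (3.2)–(3.5) p.265; Balaban1987RG1, (0.4) p.253, §2 p.267] -/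
theorem slotsTOfRecord₁₃H_succ_O3_of_hasSect2FormAtZS_of_fluctuationSlices_of_support (θ : Stage13HParams F N) (h : θ.Provisos₁₃CoPH F N)
    (p : B12.RunParams) {k : ℕ} (hkK : k < p.K)
    {hdec : DecidableEq (PBond (F.P p.K) k)} {hdec' : DecidableEq (PBond (F.P p.K) (k + 1))} (hk : k + 1 ≤ (F.P p.K).m + (F.P p.K).K)
    (s' : SeqOfRecord F θ.ν θ.τ9.M (gOfRecord₁₃ F N θ.toStage13Params p) p.K (k + 1))
    {law : SeqOfRecord F θ.ν θ.τ9.M (gOfRecord₁₃ F N θ.toStage13Params p) p.K k → Sect2.TermValues (F.P p.K) (MatA N) (FluctV N) θ.τ9.M → Prop}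
    {t : SeqOfRecord F θ.ν θ.τ9.M (gOfRecord₁₃ F N θ.toStage13Params p) p.K k → Sect2.TermValues (F.P p.K) (MatA N) (FluctV N) θ.τ9.M}
    {Ek : SeqOfRecord F θ.ν θ.τ9.M (gOfRecord₁₃ F N θ.toStage13Params p) p.K k → ℝ}
    (hform : HasSect2FormAtZS F N (FluctV N) p.K (settingOfRecord₁₃ F N θ.toStage13Params p) k (θ.rzAt p) (WtOfRecord₁₃H F N θ p)
      (UbgOfRecord₁₃CoP F N θ.toStage13Params p k) law
      (slotsOfRecord F N θ.ν θ.τ9 (EOfRecord₁₃ F N θ.toStage13Params) (wOfRecord₉ F N θ.toStage9Params) θ.ppSel p (gOfRecord₁₃ F N θ.toStage13Params p) k) t Ek)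
    (t' : Sect2.TermValues (F.P p.K) (MatA N) (FluctV N) θ.τ9.M) (E' : ℝ)
    -- measurability of the residuals serving `init s′` and `s′` (dag-n11-e's `ResidualRowsAt` shapes), of the OLD and of the NEW operand
    (hζ0m : ∀ j Y, Measurable ((θ.zhAt p s'.init).ζ0 j Y)) (hqm : ∀ j Λ', Measurable ((θ.zhAt p s'.init).quad j Λ'))
    (hΦ₀m : ∀ S₀ ∈ admSOfRecord F θ.ν θ.τ9.M (gOfRecord₁₃ F N θ.toStage13Params p) p.K k s'.init,
      Measurable fun ω : MultiCfg (F.P p.K) (SU N) (FluctV N) =>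
        (sect2Operand F N (FluctV N) p.K (settingOfRecord₁₃ F N θ.toStage13Params p) (θ.rzAt p s'.init) s'.init (t s'.init) (Ek s'.init)
            (UbgOfRecord₁₃CoP F N θ.toStage13Params p k s'.init)) (S₀, fun j => (ω j).2) (fun j => (ω j).1))
    (hζm : ∀ j Y, Measurable ((θ.zhAt p s').ζ0 j Y)) (hqm' : ∀ j Λ', Measurable ((θ.zhAt p s').quad j Λ'))
    (hΦm : ∀ S ∈ admSOfRecord F θ.ν θ.τ9.M (gOfRecord₁₃ F N θ.toStage13Params p) p.K (k + 1) s',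
      Measurable fun ω : MultiCfg (F.P p.K) (SU N) (FluctV N) =>
        (sect2Operand F N (FluctV N) p.K (settingOfRecord₁₃ F N θ.toStage13Params p) (θ.rzAt p s') s' t' E'
            (UbgOfRecord₁₃CoP F N θ.toStage13Params p (k + 1) s')) (S, fun j => (ω j).2) (fun j => (ω j).1))
    -- A FLUCTUATION-PRODUCT SOCKET `(κ₂, Ψ, J, S)` OF THE INSIDE STEP: first fibre coordinate = 11a's fluctuation variables of generation `k` (Lebesgue), + the support clause
    {X₂ : Type*} [MeasurableSpace X₂] (κ₂ : Kernel (((↥(Set.toFinite (bondsIn k (s'.Ω (k + 1))ᶜ)).toFinset → SU N) × ({c : PBond (F.P p.K) (k + 1) // c ∉ (Set.toFinite (bondsIn (k + 1) (s'.Ω (k + 1))ᶜ)).toFinset} → SU N)) × (↥(Set.toFinite (bondsIn k ((s'.Λ (k + 1))ᶜ ∩ s'.Ω (k + 1)))).toFinset → FluctV N)) X₂) [IsSFiniteKernel κ₂]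
    {Ψ : ((↥(Set.toFinite (bondsIn k (s'.Ω (k + 1))ᶜ)).toFinset → SU N) × ({c : PBond (F.P p.K) (k + 1) // c ∉ (Set.toFinite (bondsIn (k + 1) (s'.Ω (k + 1))ᶜ)).toFinset} → SU N)) × ((↥(Set.toFinite (bondsIn k ((s'.Λ (k + 1))ᶜ ∩ s'.Ω (k + 1)))).toFinset → FluctV N) × X₂) → (↥(Set.toFinite (bondsIn k (s'.Ω (k + 1))ᶜ)).toFinset → SU N) × ({b : PBond (F.P p.K) k // b ∉ (Set.toFinite (bondsIn k (s'.Ω (k + 1))ᶜ)).toFinset} → SU N)} (hΨ : Measurable Ψ)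
    {J : ((↥(Set.toFinite (bondsIn k (s'.Ω (k + 1))ᶜ)).toFinset → SU N) × ({c : PBond (F.P p.K) (k + 1) // c ∉ (Set.toFinite (bondsIn (k + 1) (s'.Ω (k + 1))ᶜ)).toFinset} → SU N)) × ((↥(Set.toFinite (bondsIn k ((s'.Λ (k + 1))ᶜ ∩ s'.Ω (k + 1)))).toFinset → FluctV N) × X₂) → ℝ≥0} (hJ : Measurable J) {S : Set ((↥(Set.toFinite (bondsIn k (s'.Ω (k + 1))ᶜ)).toFinset → SU N) × ({b : PBond (F.P p.K) k // b ∉ (Set.toFinite (bondsIn k (s'.Ω (k + 1))ᶜ)).toFinset} → SU N))}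
    (hpush : ((((Measure.pi fun _ : ↥(Set.toFinite (bondsIn k (s'.Ω (k + 1))ᶜ)).toFinset => (HaarData.haar : Measure (SU N))).prod
          (Measure.pi fun _ : {c : PBond (F.P p.K) (k + 1) // c ∉ (Set.toFinite (bondsIn (k + 1) (s'.Ω (k + 1))ᶜ)).toFinset} =>
            (HaarData.haar : Measure (SU N)))) ⊗ₘ (Kernel.const _ (Measure.pi fun _ : ↥(Set.toFinite (bondsIn k ((s'.Λ (k + 1))ᶜ ∩ s'.Ω (k + 1)))).toFinset => (volume : Measure (FluctV N))) ⊗ₖ κ₂)).withDensity (fun z => (J z : ℝ≥0∞))).map Ψ =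
      (((Measure.pi fun _ : ↥(Set.toFinite (bondsIn k (s'.Ω (k + 1))ᶜ)).toFinset => (HaarData.haar : Measure (SU N))).prod
          (Measure.pi fun _ : {b : PBond (F.P p.K) k // b ∉ (Set.toFinite (bondsIn k (s'.Ω (k + 1))ᶜ)).toFinset} => (HaarData.haar : Measure (SU N))))).restrict S)
    (hfib : ∀ᵐ z ∂((((Measure.pi fun _ : ↥(Set.toFinite (bondsIn k (s'.Ω (k + 1))ᶜ)).toFinset => (HaarData.haar : Measure (SU N))).prod
          (Measure.pi fun _ : {c : PBond (F.P p.K) (k + 1) // c ∉ (Set.toFinite (bondsIn (k + 1) (s'.Ω (k + 1))ᶜ)).toFinset} =>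
            (HaarData.haar : Measure (SU N)))) ⊗ₘ (Kernel.const _ (Measure.pi fun _ : ↥(Set.toFinite (bondsIn k ((s'.Λ (k + 1))ᶜ ∩ s'.Ω (k + 1)))).toFinset => (volume : Measure (FluctV N))) ⊗ₖ κ₂)).withDensity (fun z => (J z : ℝ≥0∞))),
      (fun q => (q.1, fun c : {c : PBond (F.P p.K) (k + 1) // c ∉ (Set.toFinite (bondsIn (k + 1) (s'.Ω (k + 1))ᶜ)).toFinset} =>
          (avOfRecord F N p.K k).avg
            ((MeasurableEquiv.piEquivPiSubtypeProd (fun _ : PBond (F.P p.K) k => SU N)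
              (· ∈ (Set.toFinite (bondsIn k (s'.Ω (k + 1))ᶜ)).toFinset)).symm q) c)) (Ψ z) = z.1)
    -- the support clause CUT IN TWO (dag-n11-w2 g4's `…OfSupport` move): def-T's half is `support_of_wOfRecord_ne_zero` (the (3.2)∕(3.3) events at the cubes of `Ω_{k+1}(s′)`
    -- wherever the step weight is non-zero, under `0 < sideD`); displayed is only the BRIDGE from those events to the charted set
    (hD : 0 < sideD F θ.ν θ.τ9.M p (gOfRecord₁₃ F N θ.toStage13Params p) k)
    (hbridge : ∀ q : (↥(Set.toFinite (bondsIn k (s'.Ω (k + 1))ᶜ)).toFinset → SU N) × ({b : PBond (F.P p.K) k // b ∉ (Set.toFinite (bondsIn k (s'.Ω (k + 1))ᶜ)).toFinset} → SU N),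
      (∀ c ∈ cubesIn (cubeχ F θ.ν p (gOfRecord₁₃ F N θ.toStage13Params p) k) (s'.Ω (k + 1)),
        PlaqSmallOn ((sect3DataOfRecord F N θ.ν θ.τ9.M p (gOfRecord₁₃ F N θ.toStage13Params p) k s'.init).plaqT c)
            (epsOfRecord θ.ν (gOfRecord₁₃ F N θ.toStage13Params p) (k + 1) * (F.P p.K).eta (k + 1) ^ 2)
            ((sect3DataOfRecord F N θ.ν θ.τ9.M p (gOfRecord₁₃ F N θ.toStage13Params p) k s'.init).UkLoc c
              ((avOfRecord F N p.K k).avg (⇑(MeasurableEquiv.piEquivPiSubtypeProd (fun _ : PBond (F.P p.K) k => SU N)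
                (· ∈ (Set.toFinite (bondsIn k (s'.Ω (k + 1))ᶜ)).toFinset)).symm q))) ∧
          SmallApproxFluct (sect3DataOfRecord F N θ.ν θ.τ9.M p (gOfRecord₁₃ F N θ.toStage13Params p) k s'.init) (avOfRecord F N p.K)
            (2 * deltaOfRecord θ.ν (gOfRecord₁₃ F N θ.toStage13Params p) k θ.A₁)
            (⇑(MeasurableEquiv.piEquivPiSubtypeProd (fun _ : PBond (F.P p.K) k => SU N) (· ∈ (Set.toFinite (bondsIn k (s'.Ω (k + 1))ᶜ)).toFinset)).symm q)
            ((avOfRecord F N p.K k).avg (⇑(MeasurableEquiv.piEquivPiSubtypeProd (fun _ : PBond (F.P p.K) k => SU N)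
                (· ∈ (Set.toFinite (bondsIn k (s'.Ω (k + 1))ᶜ)).toFinset)).symm q)) c) →
        q ∈ S)
    -- (a.1) the charted old-branch piece is integrable on the product fibre at every inside fine `y` on the averaging fibre (Fubini's proviso)
    (hIslice : ∀ᵐ q ∂((Measure.pi fun _ : ↥(Set.toFinite (bondsIn (k + 1) (s'.Ω (k + 1))ᶜ)).toFinset => (HaarData.haar : Measure (SU N))).prod
          (Measure.pi fun _ : {c : PBond (F.P p.K) (k + 1) // c ∉ (Set.toFinite (bondsIn (k + 1) (s'.Ω (k + 1))ᶜ)).toFinset} => (HaarData.haar : Measure (SU N)))),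
      ∀ S₀ ∈ admSOfRecord F θ.ν θ.τ9.M (gOfRecord₁₃ F N θ.toStage13Params p) p.K k s'.init, ∀ y : ↥(Set.toFinite (bondsIn k (s'.Ω (k + 1))ᶜ)).toFinset → SU N,
        avgRestrOfRecord F N p.K k (Set.toFinite (bondsIn k (s'.Ω (k + 1))ᶜ)).toFinset (Set.toFinite (bondsIn (k + 1) (s'.Ω (k + 1))ᶜ)).toFinset y = q.1 →
        Integrable (fun x : ((↥(Set.toFinite (bondsIn k ((s'.Λ (k + 1))ᶜ ∩ s'.Ω (k + 1)))).toFinset → FluctV N) × X₂) => (J ((y, q.2), x) : ℝ) * ((fun U => wOfRecord₉ F N θ.toStage9Params p (gOfRecord₁₃ F N θ.toStage13Params p) k s' U ((avOfRecord F N p.K k).avg U) *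
        (chiSeqOfRecord F N θ.ν θ.τ9.M (gOfRecord₁₃ F N θ.toStage13Params p) p.K k s'.init U *
          tkBranchOfRecord F N (FluctV N) θ.ν θ.τ9.M (gOfRecord₁₃ F N θ.toStage13Params p) p.K (WtOfRecord₁₃H F N θ p s'.init) s'.init S₀ k (fun ω => (sect2Operand F N (FluctV N) p.K (settingOfRecord₁₃ F N θ.toStage13Params p) (θ.rzAt p s'.init) s'.init (t s'.init) (Ek s'.init)
            (UbgOfRecord₁₃CoP F N θ.toStage13Params p k s'.init)) (S₀, fun j => (ω j).2) (fun j => (ω j).1)) (baseCfg k U))) ∘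
          ⇑(MeasurableEquiv.piEquivPiSubtypeProd (fun _ : PBond (F.P p.K) k => SU N) (· ∈ (Set.toFinite (bondsIn k (s'.Ω (k + 1))ᶜ)).toFinset)).symm) (Ψ ((y, q.2), x))) ((Kernel.const _ (Measure.pi fun _ : ↥(Set.toFinite (bondsIn k ((s'.Λ (k + 1))ᶜ ∩ s'.Ω (k + 1)))).toFinset => (volume : Measure (FluctV N))) ⊗ₖ κ₂) (y, q.2)))
    -- (b) THE PER-FLUCTUATION-SLICE IDENTITY ((3.23): the conditional `A_k|_{Λ_{k+1}}` integral of the charted old piece = ζ·χ·Gaussian weight·new operand) — displayed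
    (hslice : ∀ᵐ q ∂((Measure.pi fun _ : ↥(Set.toFinite (bondsIn (k + 1) (s'.Ω (k + 1))ᶜ)).toFinset => (HaarData.haar : Measure (SU N))).prod
          (Measure.pi fun _ : {c : PBond (F.P p.K) (k + 1) // c ∉ (Set.toFinite (bondsIn (k + 1) (s'.Ω (k + 1))ᶜ)).toFinset} => (HaarData.haar : Measure (SU N)))),
      ∀ S₀ ∈ admSOfRecord F θ.ν θ.τ9.M (gOfRecord₁₃ F N θ.toStage13Params p) p.K k s'.init, ∀ y : ↥(Set.toFinite (bondsIn k (s'.Ω (k + 1))ᶜ)).toFinset → SU N,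
        avgRestrOfRecord F N p.K k (Set.toFinite (bondsIn k (s'.Ω (k + 1))ᶜ)).toFinset (Set.toFinite (bondsIn (k + 1) (s'.Ω (k + 1))ᶜ)).toFinset y = q.1 →
        ∀ᵐ a ∂(Measure.pi fun _ : ↥(Set.toFinite (bondsIn k ((s'.Λ (k + 1))ᶜ ∩ s'.Ω (k + 1)))).toFinset => (volume : Measure (FluctV N))),
          ∫ x₂, (J ((y, q.2), (a, x₂)) : ℝ) * ((fun U => wOfRecord₉ F N θ.toStage9Params p (gOfRecord₁₃ F N θ.toStage13Params p) k s' U ((avOfRecord F N p.K k).avg U) *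
        (chiSeqOfRecord F N θ.ν θ.τ9.M (gOfRecord₁₃ F N θ.toStage13Params p) p.K k s'.init U *
          tkBranchOfRecord F N (FluctV N) θ.ν θ.τ9.M (gOfRecord₁₃ F N θ.toStage13Params p) p.K (WtOfRecord₁₃H F N θ p s'.init) s'.init S₀ k (fun ω => (sect2Operand F N (FluctV N) p.K (settingOfRecord₁₃ F N θ.toStage13Params p) (θ.rzAt p s'.init) s'.init (t s'.init) (Ek s'.init)
            (UbgOfRecord₁₃CoP F N θ.toStage13Params p k s'.init)) (S₀, fun j => (ω j).2) (fun j => (ω j).1)) (baseCfg k U))) ∘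
          ⇑(MeasurableEquiv.piEquivPiSubtypeProd (fun _ : PBond (F.P p.K) k => SU N) (· ∈ (Set.toFinite (bondsIn k (s'.Ω (k + 1))ᶜ)).toFinset)).symm) (Ψ ((y, q.2), (a, x₂))) ∂(κ₂ ((y, q.2), a)) =
            (WtOfRecord₁₃H F N θ p s').ζ k (s'.Ω (k + 1))ᶜ
                (Function.update (baseCfg (k + 1) ((MeasurableEquiv.piEquivPiSubtypeProd (fun _ : PBond (F.P p.K) (k + 1) => SU N) (· ∈ (Set.toFinite (bondsIn (k + 1) (s'.Ω (k + 1))ᶜ)).toFinset)).symm q)) k (Function.updateFinset ((baseCfg (V := FluctV N) (k + 1) ((MeasurableEquiv.piEquivPiSubtypeProd (fun _ : PBond (F.P p.K) (k + 1) => SU N) (· ∈ (Set.toFinite (bondsIn (k + 1) (s'.Ω (k + 1))ᶜ)).toFinset)).symm q)) k).1 (Set.toFinite (bondsIn k (s'.Ω (k + 1))ᶜ)).toFinset y, ((baseCfg (V := FluctV N) (k + 1) ((MeasurableEquiv.piEquivPiSubtypeProd (fun _ : PBond (F.P p.K) (k + 1) => SU N) (· ∈ (Set.toFinite (bondsIn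 (k + 1) (s'.Ω (k + 1))ᶜ)).toFinset)).symm q)) k).2)) *
              ∑ Y ∈ (Set.toFinite {Y : Set (Site (F.P p.K) 0) | Y ∈ SClassOfRecord F θ.ν (gOfRecord₁₃ F N θ.toStage13Params p) p.K (k + 1) ∧ Y ⊆ s'.Ω (k + 1) ∩ (s'.Λ (k + 1))ᶜ}).toFinset,
                (WtOfRecord₁₃H F N θ p s').w k (s'.Λ (k + 1)) ((s'.Λ (k + 1))ᶜ ∩ s'.Ω (k + 1)) Y
                    (Function.update (Function.update (baseCfg (k + 1) ((MeasurableEquiv.piEquivPiSubtypeProd (fun _ : PBond (F.P p.K) (k + 1) => SU N) (· ∈ (Set.toFinite (bondsIn (k + 1) (s'.Ω (k + 1))ᶜ)).toFinset)).symm q)) k (Function.updateFinset ((baseCfg (V := FluctV N) (k + 1) ((MeasurableEquiv.piEquivPiSubtypeProd (fun _ : PBond (F.P p.K) (k + 1) => SU N) (· ∈ (Set.toFinite (bondsIn (k + 1) (s'.Ω (k + 1))ᶜ)).toFinset)).symm q)) k).1 (Set.toFinite (bondsIn k (s'.Ω (k + 1))ᶜ)).toFinset y, ((baseCfg (V :=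 FluctV N) (k + 1) ((MeasurableEquiv.piEquivPiSubtypeProd (fun _ : PBond (F.P p.K) (k + 1) => SU N) (· ∈ (Set.toFinite (bondsIn (k + 1) (s'.Ω (k + 1))ᶜ)).toFinset)).symm q)) k).2)) k (insA (Set.toFinite (bondsIn k ((s'.Λ (k + 1))ᶜ ∩ s'.Ω (k + 1)))).toFinset a ((Function.update (baseCfg (k + 1) ((MeasurableEquiv.piEquivPiSubtypeProd (fun _ : PBond (F.P p.K) (k + 1) => SU N) (· ∈ (Set.toFinite (bondsIn (k + 1) (s'.Ω (k + 1))ᶜ)).toFinset)).symm q)) k (Function.updateFinset ((baseCfg (V := FluctV N) (k + 1) ((MeasurableEquiv.piEquivPiSubtypeProd (fun _ : PBond (F.P p.K) (k + 1) => SU N) (· ∈ (Set.toFinite (bondsIn (k + 1) (s'.Ω (k + 1))ᶜ)).toFinset)).symm q)) k).1 (Set.toFinite (bondsIn k (s'.Ω (k + 1))ᶜ)).toFinset y, ((baseCfg (V := FluctV N) (k + 1) ((MeasurableEquiv.piEquivPiSubtypeProd (fun _ : PBond (F.P p.K) (k + 1) => SU N) (· ∈ (Set.toFinite (bondsIn (k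 + 1) (s'.Ω (k + 1))ᶜ)).toFinset)).symm q)) k).2)) k))) *
                tkBranchOfRecord F N (FluctV N) θ.ν θ.τ9.M (gOfRecord₁₃ F N θ.toStage13Params p) p.K (WtOfRecord₁₃H F N θ p s') s'.init S₀ k
              (fun ω => (sect2Operand F N (FluctV N) p.K (settingOfRecord₁₃ F N θ.toStage13Params p) (θ.rzAt p s') s' t' E'
                  (UbgOfRecord₁₃CoP F N θ.toStage13Params p (k + 1) s')) (Function.update S₀ (k + 1) Y, fun j => (ω j).2) (fun j => (ω j).1))
                    (Function.update (Function.update (baseCfg (k + 1) ((MeasurableEquiv.piEquivPiSubtypeProd (fun _ : PBond (F.P p.K) (k + 1) => SU N) (· ∈ (Set.toFinite (bondsIn (k + 1) (s'.Ω (k + 1))ᶜ)).toFinset)).symm q)) k (Function.updateFinset ((baseCfg (V := FluctV N) (k + 1) ((MeasurableEquiv.piEquivPiSubtypeProd (fun _ : PBond (F.P p.K) (k + 1) => SU N) (· ∈ (Set.toFinite (bondsIn (k + 1) (s'.Ω (k + 1))ᶜ)).toFinset)).symm q)) k).1 (Set.toFinite (bondsIn k (s'.Ω (k + 1))ᶜ)).toFinset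 y, ((baseCfg (V := FluctV N) (k + 1) ((MeasurableEquiv.piEquivPiSubtypeProd (fun _ : PBond (F.P p.K) (k + 1) => SU N) (· ∈ (Set.toFinite (bondsIn (k + 1) (s'.Ω (k + 1))ᶜ)).toFinset)).symm q)) k).2)) k (insA (Set.toFinite (bondsIn k ((s'.Λ (k + 1))ᶜ ∩ s'.Ω (k + 1)))).toFinset a ((Function.update (baseCfg (k + 1) ((MeasurableEquiv.piEquivPiSubtypeProd (fun _ : PBond (F.P p.K) (k + 1) => SU N) (· ∈ (Set.toFinite (bondsIn (k + 1) (s'.Ω (k + 1))ᶜ)).toFinset)).symm q)) k (Function.updateFinset ((baseCfg (V := FluctV N) (k + 1) ((MeasurableEquiv.piEquivPiSubtypeProd (fun _ : PBond (F.P p.K) (k + 1) => SU N) (· ∈ (Set.toFinite (bondsIn (k + 1) (s'.Ω (k + 1))ᶜ)).toFinset)).symm q)) k).1 (Set.toFinite (bondsIn k (s'.Ω (k + 1))ᶜ)).toFinset y, ((baseCfg (V := FluctV N) (k + 1) ((MeasurableEquiv.piEquivPiSubtypeProd (fun _ : PBond (F.P p.K) (k + 1) => SU N) (· ∈ (Set.toFinite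 (bondsIn (k + 1) (s'.Ω (k + 1))ᶜ)).toFinset)).symm q)) k).2)) k)))) :
    slotsTOfRecord F N θ.ν θ.τ9 (EOfRecord₁₃ F N θ.toStage13Params) (wOfRecord₉ F N θ.toStage9Params) θ.ppSel p
        (gOfRecord₁₃ F N θ.toStage13Params p) (k + 1) s' = 0 ∨
      ∀ᵐ V' ∂fieldMeasure (F.P p.K) (k + 1) (SU N),
        chiSeqOfRecord F N θ.ν θ.τ9.M (gOfRecord₁₃ F N θ.toStage13Params p) p.K (k + 1) s' V' ≠ 0 →
          slotsTOfRecord F N θ.ν θ.τ9 (EOfRecord₁₃ F N θ.toStage13Params) (wOfRecord₉ F N θ.toStage9Params) θ.ppSel p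
              (gOfRecord₁₃ F N θ.toStage13Params p) (k + 1) s' V' =
            sect2Slot F N (FluctV N) p.K (settingOfRecord₁₃ F N θ.toStage13Params p) (θ.rzAt p s') (WtOfRecord₁₃H F N θ p s') s' t' E'
              (UbgOfRecord₁₃CoP F N θ.toStage13Params p (k + 1) s') V' := by
  refine BalabanUVNodesN11TStepOldBranchInnerChartFluctuationSlicesOfProvisos.slotsTOfRecord₁₃H_succ_O3_of_hasSect2FormAtZS_of_fluctuationSlices_of_provisos
    θ h p hkK (hdec := hdec) (hdec' := hdec') hk s' hform t' E' hζ0m hqm hΦ₀m hζm hqm' hΦm κ₂ hΨ hJ hpush hfib (fun q hqS => ?_) hIslice hslice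
  -- off the charted set the step weight vanishes: else def-T's half gives the (3.2)∕(3.3) events, and the bridge puts `q` in `S`
  by_contra hw
  obtain ⟨_, -, hall⟩ := support_of_wOfRecord_ne_zero θ.ν θ.τ9.M θ.A₁ θ.ζ p (gOfRecord₁₃ F N θ.toStage13Params p) k hD s' _ _ hw
  exact hqS (hbridge q hall)

/-! ## §2  `PresentChildObligations` itself at a 𝐓-present child, inside step at a fluctuation-product socket (dag-n11-d's J-twin, trigger (t2) of ■ g15) -/

/-- ★★★★★★★ **`PresentChildObligations θ p k t tnew EkN s′` FROM (O1′) + (O2) DISPLAYED AND THE (O3′) OF §1 (support clause cut in two)** — dag-n11-d g15's J (p635814 `…PresentChildO3OfPrivateInnerChart`) with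
the private-coordinate data, `hG`∕`hw0`∕`hwm`∕`hχm`∕`hgm` and `hinner₀` REPLACED by `θ.Provisos₁₃CoPH`, the residual∕operand measurability rows, a fluctuation-product socket, the support
clause, (hIslice) and THE PER-FLUCTUATION-SLICE IDENTITY at `t′ := graftAboveB k (t s′.init) (tnew s′)`, `E′ := EkN s′` — one anonymous constructor over §1.
[cite: Balaban1988Convergent, Thm 2 p.263, §3 p.279, (3.23)–(3.25) p.270, (2.27)–(2.31) pp.259–260, (2.38)–(2.42) p.261] -/
theorem presentChildObligations_of_bounds_of_hasSect2FormAtZS_of_fluctuationSlices_of_support (θ : Stage13HParams F N) (h : θ.Provisos₁₃CoPH F N)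
    (p : B12.RunParams) {k : ℕ} (hkK : k < p.K)
    {hdec : DecidableEq (PBond (F.P p.K) k)} {hdec' : DecidableEq (PBond (F.P p.K) (k + 1))} (hk : k + 1 ≤ (F.P p.K).m + (F.P p.K).K)
    (s' : SeqOfRecord F θ.ν θ.τ9.M (gOfRecord₁₃ F N θ.toStage13Params p) p.K (k + 1))
    {law : SeqOfRecord F θ.ν θ.τ9.M (gOfRecord₁₃ F N θ.toStage13Params p) p.K k → Sect2.TermValues (F.P p.K) (MatA N) (FluctV N) θ.τ9.M → Prop}
    {t : SeqOfRecord F θ.ν θ.τ9.M (gOfRecord₁₃ F N θ.toStage13Params p) p.K k → Sect2.TermValues (F.P p.K) (MatA N) (FluctV N) θ.τ9.M}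
    {Ek : SeqOfRecord F θ.ν θ.τ9.M (gOfRecord₁₃ F N θ.toStage13Params p) p.K k → ℝ}
    (hform : HasSect2FormAtZS F N (FluctV N) p.K (settingOfRecord₁₃ F N θ.toStage13Params p) k (θ.rzAt p) (WtOfRecord₁₃H F N θ p)
      (UbgOfRecord₁₃CoP F N θ.toStage13Params p k) law
      (slotsOfRecord F N θ.ν θ.τ9 (EOfRecord₁₃ F N θ.toStage13Params) (wOfRecord₉ F N θ.toStage9Params) θ.ppSel p (gOfRecord₁₃ F N θ.toStage13Params p) k) t Ek)
    (tnew : SeqOfRecord F θ.ν θ.τ9.M (gOfRecord₁₃ F N θ.toStage13Params p) p.K (k + 1) → Sect2.TermValues (F.P p.K) (MatA N) (FluctV N) θ.τ9.M)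
    (EkN : SeqOfRecord F θ.ν θ.τ9.M (gOfRecord₁₃ F N θ.toStage13Params p) p.K (k + 1) → ℝ)
    -- measurability of the residuals serving `init s′` and `s′` (dag-n11-e's `ResidualRowsAt` shapes), of the OLD and of the NEW operand
    (hζ0m : ∀ j Y, Measurable ((θ.zhAt p s'.init).ζ0 j Y)) (hqm : ∀ j Λ', Measurable ((θ.zhAt p s'.init).quad j Λ'))
    (hΦ₀m : ∀ S₀ ∈ admSOfRecord F θ.ν θ.τ9.M (gOfRecord₁₃ F N θ.toStage13Params p) p.K k s'.init,
      Measurable fun ω : MultiCfg (F.P p.K) (SU N) (FluctV N) =>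
        (sect2Operand F N (FluctV N) p.K (settingOfRecord₁₃ F N θ.toStage13Params p) (θ.rzAt p s'.init) s'.init (t s'.init) (Ek s'.init)
            (UbgOfRecord₁₃CoP F N θ.toStage13Params p k s'.init)) (S₀, fun j => (ω j).2) (fun j => (ω j).1))
    (hζm : ∀ j Y, Measurable ((θ.zhAt p s').ζ0 j Y)) (hqm' : ∀ j Λ', Measurable ((θ.zhAt p s').quad j Λ'))
    (hΦm : ∀ S ∈ admSOfRecord F θ.ν θ.τ9.M (gOfRecord₁₃ F N θ.toStage13Params p) p.K (k + 1) s',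
      Measurable fun ω : MultiCfg (F.P p.K) (SU N) (FluctV N) =>
        (sect2Operand F N (FluctV N) p.K (settingOfRecord₁₃ F N θ.toStage13Params p) (θ.rzAt p s') s' (graftAboveB k (t s'.init) (tnew s')) (EkN s')
            (UbgOfRecord₁₃CoP F N θ.toStage13Params p (k + 1) s')) (S, fun j => (ω j).2) (fun j => (ω j).1))
    -- A FLUCTUATION-PRODUCT SOCKET `(κ₂, Ψ, J, S)` OF THE INSIDE STEP: first fibre coordinate = 11a's fluctuation variables of generation `k` (Lebesgue), + the support clause
    {X₂ : Type*} [MeasurableSpace X₂] (κ₂ : Kernel (((↥(Set.toFinite (bondsIn k (s'.Ω (k + 1))ᶜ)).toFinset → SU N) × ({c : PBond (F.P p.K) (k + 1) // c ∉ (Set.toFinite (bondsIn (k + 1) (s'.Ω (k + 1))ᶜ)).toFinset} → SU N)) × (↥(Set.toFinite (bondsIn k ((s'.Λ (k + 1))ᶜ ∩ s'.Ω (k + 1)))).toFinset → FluctV N)) X₂) [IsSFiniteKernel κ₂]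
    {Ψ : ((↥(Set.toFinite (bondsIn k (s'.Ω (k + 1))ᶜ)).toFinset → SU N) × ({c : PBond (F.P p.K) (k + 1) // c ∉ (Set.toFinite (bondsIn (k + 1) (s'.Ω (k + 1))ᶜ)).toFinset} → SU N)) × ((↥(Set.toFinite (bondsIn k ((s'.Λ (k + 1))ᶜ ∩ s'.Ω (k + 1)))).toFinset → FluctV N) × X₂) → (↥(Set.toFinite (bondsIn k (s'.Ω (k + 1))ᶜ)).toFinset → SU N) × ({b : PBond (F.P p.K) k // b ∉ (Set.toFinite (bondsIn k (s'.Ω (k + 1))ᶜ)).toFinset} → SU N)} (hΨ : Measurable Ψ)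
    {J : ((↥(Set.toFinite (bondsIn k (s'.Ω (k + 1))ᶜ)).toFinset → SU N) × ({c : PBond (F.P p.K) (k + 1) // c ∉ (Set.toFinite (bondsIn (k + 1) (s'.Ω (k + 1))ᶜ)).toFinset} → SU N)) × ((↥(Set.toFinite (bondsIn k ((s'.Λ (k + 1))ᶜ ∩ s'.Ω (k + 1)))).toFinset → FluctV N) × X₂) → ℝ≥0} (hJ : Measurable J) {S : Set ((↥(Set.toFinite (bondsIn k (s'.Ω (k + 1))ᶜ)).toFinset → SU N) × ({b : PBond (F.P p.K) k // b ∉ (Set.toFinite (bondsIn k (s'.Ω (k + 1))ᶜ)).toFinset} → SU N))}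
    (hpush : ((((Measure.pi fun _ : ↥(Set.toFinite (bondsIn k (s'.Ω (k + 1))ᶜ)).toFinset => (HaarData.haar : Measure (SU N))).prod
          (Measure.pi fun _ : {c : PBond (F.P p.K) (k + 1) // c ∉ (Set.toFinite (bondsIn (k + 1) (s'.Ω (k + 1))ᶜ)).toFinset} =>
            (HaarData.haar : Measure (SU N)))) ⊗ₘ (Kernel.const _ (Measure.pi fun _ : ↥(Set.toFinite (bondsIn k ((s'.Λ (k + 1))ᶜ ∩ s'.Ω (k + 1)))).toFinset => (volume : Measure (FluctV N))) ⊗ₖ κ₂)).withDensity (fun z => (J z : ℝ≥0∞))).map Ψ =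
      (((Measure.pi fun _ : ↥(Set.toFinite (bondsIn k (s'.Ω (k + 1))ᶜ)).toFinset => (HaarData.haar : Measure (SU N))).prod
          (Measure.pi fun _ : {b : PBond (F.P p.K) k // b ∉ (Set.toFinite (bondsIn k (s'.Ω (k + 1))ᶜ)).toFinset} => (HaarData.haar : Measure (SU N))))).restrict S)
    (hfib : ∀ᵐ z ∂((((Measure.pi fun _ : ↥(Set.toFinite (bondsIn k (s'.Ω (k + 1))ᶜ)).toFinset => (HaarData.haar : Measure (SU N))).prod
          (Measure.pi fun _ : {c : PBond (F.P p.K) (k + 1) // c ∉ (Set.toFinite (bondsIn (k + 1) (s'.Ω (k + 1))ᶜ)).toFinset} =>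
            (HaarData.haar : Measure (SU N)))) ⊗ₘ (Kernel.const _ (Measure.pi fun _ : ↥(Set.toFinite (bondsIn k ((s'.Λ (k + 1))ᶜ ∩ s'.Ω (k + 1)))).toFinset => (volume : Measure (FluctV N))) ⊗ₖ κ₂)).withDensity (fun z => (J z : ℝ≥0∞))),
      (fun q => (q.1, fun c : {c : PBond (F.P p.K) (k + 1) // c ∉ (Set.toFinite (bondsIn (k + 1) (s'.Ω (k + 1))ᶜ)).toFinset} =>
          (avOfRecord F N p.K k).avg
            ((MeasurableEquiv.piEquivPiSubtypeProd (fun _ : PBond (F.P p.K) k => SU N)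
              (· ∈ (Set.toFinite (bondsIn k (s'.Ω (k + 1))ᶜ)).toFinset)).symm q) c)) (Ψ z) = z.1)
    -- the support clause CUT IN TWO (dag-n11-w2 g4's `…OfSupport` move): def-T's half is `support_of_wOfRecord_ne_zero` (the (3.2)∕(3.3) events at the cubes of `Ω_{k+1}(s′)`
    -- wherever the step weight is non-zero, under `0 < sideD`); displayed is only the BRIDGE from those events to the charted set
    (hD : 0 < sideD F θ.ν θ.τ9.M p (gOfRecord₁₃ F N θ.toStage13Params p) k)
    (hbridge : ∀ q : (↥(Set.toFinite (bondsIn k (s'.Ω (k + 1))ᶜ)).toFinset → SU N) × ({b : PBond (F.P p.K) k // b ∉ (Set.toFinite (bondsIn k (s'.Ω (k + 1))ᶜ)).toFinset} → SU N),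
      (∀ c ∈ cubesIn (cubeχ F θ.ν p (gOfRecord₁₃ F N θ.toStage13Params p) k) (s'.Ω (k + 1)),
        PlaqSmallOn ((sect3DataOfRecord F N θ.ν θ.τ9.M p (gOfRecord₁₃ F N θ.toStage13Params p) k s'.init).plaqT c)
            (epsOfRecord θ.ν (gOfRecord₁₃ F N θ.toStage13Params p) (k + 1) * (F.P p.K).eta (k + 1) ^ 2)
            ((sect3DataOfRecord F N θ.ν θ.τ9.M p (gOfRecord₁₃ F N θ.toStage13Params p) k s'.init).UkLoc c
              ((avOfRecord F N p.K k).avg (⇑(MeasurableEquiv.piEquivPiSubtypeProd (fun _ : PBond (F.P p.K) k => SU N)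
                (· ∈ (Set.toFinite (bondsIn k (s'.Ω (k + 1))ᶜ)).toFinset)).symm q))) ∧
          SmallApproxFluct (sect3DataOfRecord F N θ.ν θ.τ9.M p (gOfRecord₁₃ F N θ.toStage13Params p) k s'.init) (avOfRecord F N p.K)
            (2 * deltaOfRecord θ.ν (gOfRecord₁₃ F N θ.toStage13Params p) k θ.A₁)
            (⇑(MeasurableEquiv.piEquivPiSubtypeProd (fun _ : PBond (F.P p.K) k => SU N) (· ∈ (Set.toFinite (bondsIn k (s'.Ω (k + 1))ᶜ)).toFinset)).symm q)
            ((avOfRecord F N p.K k).avg (⇑(MeasurableEquiv.piEquivPiSubtypeProd (fun _ : PBond (F.P p.K) k => SU N)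
                (· ∈ (Set.toFinite (bondsIn k (s'.Ω (k + 1))ᶜ)).toFinset)).symm q)) c) →
        q ∈ S)
    -- (a.1) the charted old-branch piece is integrable on the product fibre at every inside fine `y` on the averaging fibre (Fubini's proviso)
    (hIslice : ∀ᵐ q ∂((Measure.pi fun _ : ↥(Set.toFinite (bondsIn (k + 1) (s'.Ω (k + 1))ᶜ)).toFinset => (HaarData.haar : Measure (SU N))).prod
          (Measure.pi fun _ : {c : PBond (F.P p.K) (k + 1) // c ∉ (Set.toFinite (bondsIn (k + 1) (s'.Ω (k + 1))ᶜ)).toFinset} => (HaarData.haar : Measure (SU N)))),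
      ∀ S₀ ∈ admSOfRecord F θ.ν θ.τ9.M (gOfRecord₁₃ F N θ.toStage13Params p) p.K k s'.init, ∀ y : ↥(Set.toFinite (bondsIn k (s'.Ω (k + 1))ᶜ)).toFinset → SU N,
        avgRestrOfRecord F N p.K k (Set.toFinite (bondsIn k (s'.Ω (k + 1))ᶜ)).toFinset (Set.toFinite (bondsIn (k + 1) (s'.Ω (k + 1))ᶜ)).toFinset y = q.1 →
        Integrable (fun x : ((↥(Set.toFinite (bondsIn k ((s'.Λ (k + 1))ᶜ ∩ s'.Ω (k + 1)))).toFinset → FluctV N) × X₂) => (J ((y, q.2), x) : ℝ) * ((fun U => wOfRecord₉ F N θ.toStage9Params p (gOfRecord₁₃ F N θ.toStage13Params p) k s' U ((avOfRecord F N p.K k).avg U) *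
        (chiSeqOfRecord F N θ.ν θ.τ9.M (gOfRecord₁₃ F N θ.toStage13Params p) p.K k s'.init U *
          tkBranchOfRecord F N (FluctV N) θ.ν θ.τ9.M (gOfRecord₁₃ F N θ.toStage13Params p) p.K (WtOfRecord₁₃H F N θ p s'.init) s'.init S₀ k (fun ω => (sect2Operand F N (FluctV N) p.K (settingOfRecord₁₃ F N θ.toStage13Params p) (θ.rzAt p s'.init) s'.init (t s'.init) (Ek s'.init)
            (UbgOfRecord₁₃CoP F N θ.toStage13Params p k s'.init)) (S₀, fun j => (ω j).2) (fun j => (ω j).1)) (baseCfg k U))) ∘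
          ⇑(MeasurableEquiv.piEquivPiSubtypeProd (fun _ : PBond (F.P p.K) k => SU N) (· ∈ (Set.toFinite (bondsIn k (s'.Ω (k + 1))ᶜ)).toFinset)).symm) (Ψ ((y, q.2), x))) ((Kernel.const _ (Measure.pi fun _ : ↥(Set.toFinite (bondsIn k ((s'.Λ (k + 1))ᶜ ∩ s'.Ω (k + 1)))).toFinset => (volume : Measure (FluctV N))) ⊗ₖ κ₂) (y, q.2)))
    -- (b) THE PER-FLUCTUATION-SLICE IDENTITY ((3.23): the conditional `A_k|_{Λ_{k+1}}` integral of the charted old piece = ζ·χ·Gaussian weight·new operand) — displayed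
    (hslice : ∀ᵐ q ∂((Measure.pi fun _ : ↥(Set.toFinite (bondsIn (k + 1) (s'.Ω (k + 1))ᶜ)).toFinset => (HaarData.haar : Measure (SU N))).prod
          (Measure.pi fun _ : {c : PBond (F.P p.K) (k + 1) // c ∉ (Set.toFinite (bondsIn (k + 1) (s'.Ω (k + 1))ᶜ)).toFinset} => (HaarData.haar : Measure (SU N)))),
      ∀ S₀ ∈ admSOfRecord F θ.ν θ.τ9.M (gOfRecord₁₃ F N θ.toStage13Params p) p.K k s'.init, ∀ y : ↥(Set.toFinite (bondsIn k (s'.Ω (k + 1))ᶜ)).toFinset → SU N,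
        avgRestrOfRecord F N p.K k (Set.toFinite (bondsIn k (s'.Ω (k + 1))ᶜ)).toFinset (Set.toFinite (bondsIn (k + 1) (s'.Ω (k + 1))ᶜ)).toFinset y = q.1 →
        ∀ᵐ a ∂(Measure.pi fun _ : ↥(Set.toFinite (bondsIn k ((s'.Λ (k + 1))ᶜ ∩ s'.Ω (k + 1)))).toFinset => (volume : Measure (FluctV N))),
          ∫ x₂, (J ((y, q.2), (a, x₂)) : ℝ) * ((fun U => wOfRecord₉ F N θ.toStage9Params p (gOfRecord₁₃ F N θ.toStage13Params p) k s' U ((avOfRecord F N p.K k).avg U) *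
        (chiSeqOfRecord F N θ.ν θ.τ9.M (gOfRecord₁₃ F N θ.toStage13Params p) p.K k s'.init U *
          tkBranchOfRecord F N (FluctV N) θ.ν θ.τ9.M (gOfRecord₁₃ F N θ.toStage13Params p) p.K (WtOfRecord₁₃H F N θ p s'.init) s'.init S₀ k (fun ω => (sect2Operand F N (FluctV N) p.K (settingOfRecord₁₃ F N θ.toStage13Params p) (θ.rzAt p s'.init) s'.init (t s'.init) (Ek s'.init)
            (UbgOfRecord₁₃CoP F N θ.toStage13Params p k s'.init)) (S₀, fun j => (ω j).2) (fun j => (ω j).1)) (baseCfg k U))) ∘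
          ⇑(MeasurableEquiv.piEquivPiSubtypeProd (fun _ : PBond (F.P p.K) k => SU N) (· ∈ (Set.toFinite (bondsIn k (s'.Ω (k + 1))ᶜ)).toFinset)).symm) (Ψ ((y, q.2), (a, x₂))) ∂(κ₂ ((y, q.2), a)) =
            (WtOfRecord₁₃H F N θ p s').ζ k (s'.Ω (k + 1))ᶜ
                (Function.update (baseCfg (k + 1) ((MeasurableEquiv.piEquivPiSubtypeProd (fun _ : PBond (F.P p.K) (k + 1) => SU N) (· ∈ (Set.toFinite (bondsIn (k + 1) (s'.Ω (k + 1))ᶜ)).toFinset)).symm q)) k (Function.updateFinset ((baseCfg (V := FluctV N) (k + 1) ((MeasurableEquiv.piEquivPiSubtypeProd (fun _ : PBond (F.P p.K) (k + 1) => SU N) (· ∈ (Set.toFinite (bondsIn (k + 1) (s'.Ω (k + 1))ᶜ)).toFinset)).symm q)) k).1 (Set.toFinite (bondsIn k (s'.Ω (k + 1))ᶜ)).toFinset y, ((baseCfg (V := FluctV N) (k + 1) ((MeasurableEquiv.piEquivPiSubtypeProd (fun _ : PBond (F.P p.K) (k + 1) => SU N) (· ∈ (Set.toFinite (bondsIn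 (k + 1) (s'.Ω (k + 1))ᶜ)).toFinset)).symm q)) k).2)) *
              ∑ Y ∈ (Set.toFinite {Y : Set (Site (F.P p.K) 0) | Y ∈ SClassOfRecord F θ.ν (gOfRecord₁₃ F N θ.toStage13Params p) p.K (k + 1) ∧ Y ⊆ s'.Ω (k + 1) ∩ (s'.Λ (k + 1))ᶜ}).toFinset,
                (WtOfRecord₁₃H F N θ p s').w k (s'.Λ (k + 1)) ((s'.Λ (k + 1))ᶜ ∩ s'.Ω (k + 1)) Y
                    (Function.update (Function.update (baseCfg (k + 1) ((MeasurableEquiv.piEquivPiSubtypeProd (fun _ : PBond (F.P p.K) (k + 1) => SU N) (· ∈ (Set.toFinite (bondsIn (k + 1) (s'.Ω (k + 1))ᶜ)).toFinset)).symm q)) k (Function.updateFinset ((baseCfg (V := FluctV N) (k + 1) ((MeasurableEquiv.piEquivPiSubtypeProd (fun _ : PBond (F.P p.K) (k + 1) => SU N) (· ∈ (Set.toFinite (bondsIn (k + 1) (s'.Ω (k + 1))ᶜ)).toFinset)).symm q)) k).1 (Set.toFinite (bondsIn k (s'.Ω (k + 1))ᶜ)).toFinset y, ((baseCfg (V :=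 FluctV N) (k + 1) ((MeasurableEquiv.piEquivPiSubtypeProd (fun _ : PBond (F.P p.K) (k + 1) => SU N) (· ∈ (Set.toFinite (bondsIn (k + 1) (s'.Ω (k + 1))ᶜ)).toFinset)).symm q)) k).2)) k (insA (Set.toFinite (bondsIn k ((s'.Λ (k + 1))ᶜ ∩ s'.Ω (k + 1)))).toFinset a ((Function.update (baseCfg (k + 1) ((MeasurableEquiv.piEquivPiSubtypeProd (fun _ : PBond (F.P p.K) (k + 1) => SU N) (· ∈ (Set.toFinite (bondsIn (k + 1) (s'.Ω (k + 1))ᶜ)).toFinset)).symm q)) k (Function.updateFinset ((baseCfg (V := FluctV N) (k + 1) ((MeasurableEquiv.piEquivPiSubtypeProd (fun _ : PBond (F.P p.K) (k + 1) => SU N) (· ∈ (Set.toFinite (bondsIn (k + 1) (s'.Ω (k + 1))ᶜ)).toFinset)).symm q)) k).1 (Set.toFinite (bondsIn k (s'.Ω (k + 1))ᶜ)).toFinset y, ((baseCfg (V := FluctV N) (k + 1) ((MeasurableEquiv.piEquivPiSubtypeProd (fun _ : PBond (F.P p.K) (k + 1) => SU N) (· ∈ (Set.toFinite (bondsIn (k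 + 1) (s'.Ω (k + 1))ᶜ)).toFinset)).symm q)) k).2)) k))) *
                tkBranchOfRecord F N (FluctV N) θ.ν θ.τ9.M (gOfRecord₁₃ F N θ.toStage13Params p) p.K (WtOfRecord₁₃H F N θ p s') s'.init S₀ k
              (fun ω => (sect2Operand F N (FluctV N) p.K (settingOfRecord₁₃ F N θ.toStage13Params p) (θ.rzAt p s') s' (graftAboveB k (t s'.init) (tnew s')) (EkN s')
                  (UbgOfRecord₁₃CoP F N θ.toStage13Params p (k + 1) s')) (Function.update S₀ (k + 1) Y, fun j => (ω j).2) (fun j => (ω j).1))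
                    (Function.update (Function.update (baseCfg (k + 1) ((MeasurableEquiv.piEquivPiSubtypeProd (fun _ : PBond (F.P p.K) (k + 1) => SU N) (· ∈ (Set.toFinite (bondsIn (k + 1) (s'.Ω (k + 1))ᶜ)).toFinset)).symm q)) k (Function.updateFinset ((baseCfg (V := FluctV N) (k + 1) ((MeasurableEquiv.piEquivPiSubtypeProd (fun _ : PBond (F.P p.K) (k + 1) => SU N) (· ∈ (Set.toFinite (bondsIn (k + 1) (s'.Ω (k + 1))ᶜ)).toFinset)).symm q)) k).1 (Set.toFinite (bondsIn k (s'.Ω (k + 1))ᶜ)).toFinset y, ((baseCfg (V := FluctV N) (k + 1) ((MeasurableEquiv.piEquivPiSubtypeProd (fun _ : PBond (F.P p.K) (k + 1) => SU N) (· ∈ (Set.toFinite (bondsIn (k + 1) (s'.Ω (k + 1))ᶜ)).toFinset)).symm q)) k).2)) k (insA (Set.toFinite (bondsIn k ((s'.Λ (k + 1))ᶜ ∩ s'.Ω (k + 1)))).toFinset a ((Function.update (baseCfg (k + 1) ((MeasurableEquiv.piEquivPiSubtypeProd (fun _ : PBond (F.P p.K) (k + 1) => SU N) (· ∈ (Set.toFinite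 (bondsIn (k + 1) (s'.Ω (k + 1))ᶜ)).toFinset)).symm q)) k (Function.updateFinset ((baseCfg (V := FluctV N) (k + 1) ((MeasurableEquiv.piEquivPiSubtypeProd (fun _ : PBond (F.P p.K) (k + 1) => SU N) (· ∈ (Set.toFinite (bondsIn (k + 1) (s'.Ω (k + 1))ᶜ)).toFinset)).symm q)) k).1 (Set.toFinite (bondsIn k (s'.Ω (k + 1))ᶜ)).toFinset y, ((baseCfg (V := FluctV N) (k + 1) ((MeasurableEquiv.piEquivPiSubtypeProd (fun _ : PBond (F.P p.K) (k + 1) => SU N) (· ∈ (Set.toFinite (bondsIn (k + 1) (s'.Ω (k + 1))ᶜ)).toFinset)).symm q)) k).2)) k))))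
    -- (O1′) the supplier's own level-`k` boundary term on the child's space
    (hO1 : (1 ≤ k →
    (∀ (X : (Sect2.domSys (F.P p.K) θ.τ9.M k).Dom) (φ : Sect2.CPair (F.P p.K) (MatA N)) (a : SFluct (F.P p.K) (FluctV N)),
      φ ∈ (sect2TowerOfRecord F N (FluctV N) p.K (settingOfRecord₁₃ F N θ.toStage13Params p) (θ.rzAt p s') s' (tnew s')).spaceB k X →
        ‖(tnew s').B k X φ a‖ ≤ (settingOfRecord₁₃ F N θ.toStage13Params p).lf.B₀ * Real.exp (-(settingOfRecord₁₃ F N θ.toStage13Params p).lf.κ * (Sect2.domSys (F.P p.K) θ.τ9.M k).dj X)) ∧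
    (∀ (X : (Sect2.domSys (F.P p.K) θ.τ9.M k).Dom) (a : SFluct (F.P p.K) (FluctV N)),
      AnalyticOnNhd ℂ (fun φ => (tnew s').B k X φ a)
        ((sect2TowerOfRecord F N (FluctV N) p.K (settingOfRecord₁₃ F N θ.toStage13Params p) (θ.rzAt p s') s' (tnew s')).spaceB k X))))
    -- (O2) r11's new-term obligations and analyticity at `k+1`
    (hO2 : Step.LFNewTerms (sect2TowerOfRecord F N (FluctV N) p.K (settingOfRecord₁₃ F N θ.toStage13Params p) (θ.rzAt p s') s' (tnew s'))
    (settingOfRecord₁₃ F N θ.toStage13Params p).lf (settingOfRecord₁₃ F N θ.toStage13Params p).βc k)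
    (hO3 : (∀ (X : (Sect2.domSys (F.P p.K) θ.τ9.M (k + 1)).Dom) (z : Site (F.P p.K) (k + 1)) (g : ℝ), 0 ≤ g → g ≤ (settingOfRecord₁₃ F N θ.toStage13Params p).lf.γ →
    AnalyticOnNhd ℂ ((tnew s').E (k + 1) X z g)
      ((sect2TowerOfRecord F N (FluctV N) p.K (settingOfRecord₁₃ F N θ.toStage13Params p) (θ.rzAt p s') s' (tnew s')).space (k + 1) X
        ((settingOfRecord₁₃ F N θ.toStage13Params p).lf.alpha0 ((settingOfRecord₁₃ F N θ.toStage13Params p).flow.g (k + 1)))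
        ((settingOfRecord₁₃ F N θ.toStage13Params p).lf.alpha1 ((settingOfRecord₁₃ F N θ.toStage13Params p).flow.g (k + 1))))))
    (hO4 : (∀ X : (Sect2.domSys (F.P p.K) θ.τ9.M (k + 1)).Dom,
    AnalyticOnNhd ℂ ((tnew s').R (k + 1) X)
      ((sect2TowerOfRecord F N (FluctV N) p.K (settingOfRecord₁₃ F N θ.toStage13Params p) (θ.rzAt p s') s' (tnew s')).space (k + 1) X
        ((settingOfRecord₁₃ F N θ.toStage13Params p).lf.alpha0 ((settingOfRecord₁₃ F N θ.toStage13Params p).flow.g (k + 1)))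
        ((settingOfRecord₁₃ F N θ.toStage13Params p).lf.alpha1 ((settingOfRecord₁₃ F N θ.toStage13Params p).flow.g (k + 1))))))
    (hO5 : (∀ (X : (Sect2.domSys (F.P p.K) θ.τ9.M (k + 1)).Dom) (a : SFluct (F.P p.K) (FluctV N)),
    AnalyticOnNhd ℂ (fun φ => (tnew s').B (k + 1) X φ a)
      ((sect2TowerOfRecord F N (FluctV N) p.K (settingOfRecord₁₃ F N θ.toStage13Params p) (θ.rzAt p s') s' (tnew s')).spaceB (k + 1) X))) :
    PresentChildObligations θ p k t tnew EkN s' :=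
  ⟨hO1, hO2, hO3, hO4, hO5,
    slotsTOfRecord₁₃H_succ_O3_of_hasSect2FormAtZS_of_fluctuationSlices_of_support θ h p hkK (hdec := hdec) (hdec' := hdec') hk s' hform
      (graftAboveB k (t s'.init) (tnew s')) (EkN s') hζ0m hqm hΦ₀m hζm hqm' hΦm κ₂ hΨ hJ hpush hfib hD hbridge hIslice hslice⟩

end Summit.QuantumFields.YangMills.Theorems.BalabanUVNodesN11TStepOldBranchInnerChartFluctuationSlicesOfSupport

end
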